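import Literature.NumberTheory.EllipticCurves.CastellaLiuWan2022.GreenbergDivisibilityAwayFromCyclotomicSemistableTwist
import HarnessLib

/-!
# Castella–Liu–Wan 2022, Thm. 8.2.1 / §6.1 — the `p*`-TWIST reading IS the case `d = 1` of the SEMISTABLE-TWIST reading (proofs companion)

Companion (theorems only; no definition, no `sorry`) of `GreenbergDivisibilityAwayFromCyclotomicSemistableTwist.lean` (LEAD
cruxlead-19357 g13) and `GreenbergDivisibilityAwayFromCyclotomic.lean` (typer `bsd-addord-ty-clw1`). The two named facts of the former,
`thm821_XGr₂_charIdeal_mul_le_awayFromCyc_semistableTwist` and `sec61_exists_isCastellaLiuWanLFunction₂_semistableTwist` (print Thm. 8.2.1 and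
§6.1 read on `E = V₀ ⊗ χ_{p*·d}`, `V₀` semistable, `d ≡ 1 (mod 4)`, `p ∤ d`, primes of `d` split in `𝒦`), IMPLY the two named facts of the latter
(`…_pStarTwist`: the same read on `E = V ⊗ χ_{p*}`) by taking `d = 1` — the binders agree verbatim after `p*·1 = p*`, `1 % 4 = 1`, `p ∤ 1`, and
the vacuous splitting clause. This records in the kernel that the cell's cite lists lost nothing by the swap (skeleton v34 of crux 19357).

* `thm821_pStarTwist_of_semistableTwist`, `sec61_pStarTwist_of_semistableTwist`.
-/

noncomputable section

open scoped Classical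

open PowerSeries NumberField IsDedekindDomain Field CongruenceSubgroup
  Literature.NumberTheory.GaloisRepresentations Literature.NumberTheory.EllipticCurves
  Literature.NumberTheory.EllipticCurves.ModularForms

namespace Literature.NumberTheory.EllipticCurves.CastellaLiuWan2022

/-- **The `p*`-twist reading of print Thm. 8.2.1 (∘ JSW 6.1.6) is the case `d = 1` of the semistable-twist reading.**
[cite: CastellaLiuWan2022, Thm. 8.2.1 p. 85 (Forum Math. Sigma 10 (2022) e110)] -/
theorem thm821_pStarTwist_of_semistableTwist (h : thm821_XGr₂_charIdeal_mul_le_awayFromCyc_semistableTwist) :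
    thm821_XGr₂_charIdeal_mul_le_awayFromCyc_pStarTwist := by
  intro p _ ι V W _ _ _ _ K _ _ 𝔭 𝔭' κ₁ κ₂ γ₁ γ₂ _ N _ f hf NV hVW hN hNV hp2 hsq hpN hK hpsplit h𝔭 h𝔭' hne hι hq h2 hirr hκ htors
    Ωinf C Ωp A B hΩ hC hL J hJ
  have hVW' : ∃ C : WeierstrassCurve.VariableChange ℚ, C • W.quadraticTwist ((-1 : ℚ) ^ (p / 2) * p * (1 : ℤ)) = V := by
    simpa using hVW
  have hp1 : ¬ (p : ℤ) ∣ (1 : ℤ) := fun hd ↦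
    (Fact.out : p.Prime).one_lt.ne' (by exact_mod_cast Int.eq_one_of_dvd_one (by exact_mod_cast (Nat.zero_le p)) hd)
  exact h ι V W K 𝔭 𝔭' κ₁ κ₂ γ₁ γ₂ hf NV 1 hVW' (by norm_num) hp1 (fun ℓ hℓ hℓ1 ↦ absurd (Int.eq_one_of_dvd_one (by positivity) hℓ1)
    (by exact_mod_cast hℓ.one_lt.ne')) hN hNV hp2 hsq hpN hK hpsplit h𝔭 h𝔭' hne hι hq h2 hirr hκ htors Ωinf C Ωp A B hΩ hC hL J hJ

/-- **The `p*`-twist reading of the §6.1 existence is the case `d = 1` of the semistable-twist reading.**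
[cite: CastellaLiuWan2022, §6.1 p. 51 (Forum Math. Sigma 10 (2022) e110)] -/
theorem sec61_pStarTwist_of_semistableTwist (h : sec61_exists_isCastellaLiuWanLFunction₂_semistableTwist) :
    sec61_exists_isCastellaLiuWanLFunction₂_pStarTwist := by
  intro p _ ι V W _ _ _ _ K _ _ 𝔭 𝔭' κ₁ κ₂ γ₁ γ₂ _ N _ f hf NV hVW hN hNV hp2 hsq hpN hK hpsplit h𝔭 h𝔭' hne hι hq h2 hirr hκ
  have hVW' : ∃ C : WeierstrassCurve.VariableChange ℚ, C • W.quadraticTwist ((-1 : ℚ) ^ (p / 2) * p * (1 : ℤ)) = V := by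
    simpa using hVW
  have hp1 : ¬ (p : ℤ) ∣ (1 : ℤ) := fun hd ↦
    (Fact.out : p.Prime).one_lt.ne' (by exact_mod_cast Int.eq_one_of_dvd_one (by exact_mod_cast (Nat.zero_le p)) hd)
  exact h ι V W K 𝔭 𝔭' κ₁ κ₂ γ₁ γ₂ hf NV 1 hVW' (by norm_num) hp1 (fun ℓ hℓ hℓ1 ↦ absurd (Int.eq_one_of_dvd_one (by positivity) hℓ1)
    (by exact_mod_cast hℓ.one_lt.ne')) hN hNV hp2 hsq hpN hK hpsplit h𝔭 h𝔭' hne hι hq h2 hirr hκ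

end Literature.NumberTheory.EllipticCurves.CastellaLiuWan2022

end
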